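import Summits.AtomisticToContinuum.BoseEinsteinCondensation.Theses.BECWallDressingTransfer

/-!
# Birth skeleton for crux `BECWallDressingTransfer.TorusLandscapeDirichletTypical`
(item stmt-AtomisticToContinuum-13826, route route-AtomisticToContinuum-BECWallDressingTransfer, rank 3;
skeleton registrar planner-skel-stmt-AtomisticToContinuum-13826-0, 2026-08-17; published as
`Cruxes/TorusLandscapeDirichletTypical/Lines/birth.lean`)

Crux T (FIXED, concluded BY NAME below).  `N + 1` bosons, `L = sideLength ρ (N + 1)`,
`Ψ₀ = groundState v (N + 1) L` (Dirichlet box `(0, L)³`), `Φ₀` = a torus ground state of side `L + a`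
(inlined interface: continuous, periodic, `≥ 0`, `L²(cell^(N+1))`-limit up to phase of all periodic
near-minimisers), `x :: Y = Matrix.vecCons x Y`, inner cube `Λ'_ε = (εL, L − εL)³` of the BOX,
`Bad(c) = {Y | (∫_Λ' Φ₀(x::Y) dx)² ≤ c · |Λ'| · ∫_Λ' Φ₀(x::Y)² dx}` (the torus slice is NOT delocalised):
for every admissible `v` there is `a₀ ≥ 0` such that for `a ≥ a₀`, small `ρ`, `ε ∈ [0, 1/4)`, `η > 0`
some `c > 0` gives, eventually in `N`, under `HasUniqueGroundState`,
`w_D(Bad(c)) := ∫ 1_Bad(Y) (∫ Ψ₀(x::Y)² dx) dY ≤ η` — the torus landscape is delocalised for environments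
typical under the DIRICHLET law `w_D`.

## The line = the route's own two-layer plan for T, typed at SURFACE speed `N^(2/3)`

Two laws of the environment `Y ∈ (ℝ³)^N` enter: the Dirichlet law `w_D(dY) = (∫ Ψ₀(x::Y)² dx) dY`
(a probability law when the ground state exists: `lintegral_groundState_sq`) and the TORUS law
`π_P(dY) = 1_{cell^N}(Y) (∫_cell Φ₀(x::Y)² dx) dY`, `cell = [0, L + a)³` (a probability law for an
interface `Φ₀`: the interface pins `∫_{cell^(N+1)} Φ₀² = 1`, and `cell^(N+1) ≅ cell × cell^N` under `::`).
The route file (TWO-LAYER PLAN) foresees exactly `T ⇐ TorusLandscapeTypical → WallConditioningStability`,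
"exponential concentration at speed N^(2/3) suffices" because "the relative entropy H(w_D|π_P) is the
surface-order quantity".  The two stubs are these two children with the rates made explicit:

* `stub_torusLandscapeLD` (size XL; torus-side ONLY — no `Ψ₀`, no `HasUniqueGroundState`) —
  LARGE-DEVIATION FORM OF TORUS-LANDSCAPE TYPICALITY: for every rate `κ > 0` there is `c > 0` with
  `π_P(Bad(c)) ≤ exp(−κ N^(2/3))` eventually in `N`, for every interface `Φ₀`.  Why plausible: to make the
  slice `x ↦ Φ₀(x::Y)` concentrate on a fraction `≲ c` of `Λ'` the `N` environment particles would have to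
  deplete most of a macroscopic cube, a bulk large deviation under the homogeneous torus state (cost
  `exp(−Θ(N)) ≪ exp(−κN^(2/3))`); in the Jastrow caricature `Φ₀ ≈ ∏ f(xᵢ − xⱼ)` the event is even EMPTY for
  `c < e^(−O(1))` (refuter note on the item: Jensen gives `c ≈ e^(−1/2)` deterministically in `Y`).  Why it
  might fail: it is a typical-environment (not `γ`-averaged) statement about THE torus ground state at fixed
  `ρ` with `L → ∞`; the torus engines in print (Fournais2020 Thm 1.2, in tree as `Fournais2020_condensation`;
  arXiv:2603.20776; arXiv:2510.20493) deliver `π_P`-AVERAGES on GP++ length scales only.  False in `d = 1`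
  (Barriers/AtomisticToContinuum/PitaevskiiStringariOneDimension) exactly like T.
* `stub_wallConditioningDomination` (size L–XL; the change of measure) — WALL-CONDITIONING STABILITY IN
  SMOOTHED EXPONENTIAL-DOMINATION FORM: for every `η₀ > 0` there is `K > 0` with, eventually in `N`, for
  EVERY measurable set `E` of environments, `w_D(E) ≤ η₀ + exp(K N^(2/3)) · π_P(E)`.  Why plausible: it
  follows from the surface-order relative-entropy bound `H(w_D | π_P) ≤ K' N^(2/3)` by the entropy
  inequality `w_D(E) ≤ (H + log 2) / log(1/π_P(E))` (take `K = (K' + 1)/η₀`); `H` is surface order because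
  `dw_D/dπ_P ≲ Z⁻²` with `Z² = E_P[∏ᵢ s(xᵢ)²] = exp(−O(N · ℓ/L)) = exp(−O(N^(2/3)))` in the wall-dressing
  picture of the route (`s` = one-body wall profile of width `ℓ ≍` healing length), or directly: all `N`
  particles inside `(0,L)³ ⊂ [0,L+a)³` costs `(L/(L+a))^(3N) = exp(−3aρ^(1/3)N^(2/3)(1+o(1)))` and the depleted
  wall layer displaces `O(ρ ξ L²) = O(N^(2/3))` particles.  Absolute continuity `w_D ≪ π_P` on `box^N` needs
  the enlarged torus (`a ≥ a₀ > range v`: no periodic-image hard-core zeros for `Y ∈ box^N`) — the stub lets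
  the prover choose `a₀`.  Why it might fail: this IS the crux's recorded why-might-fail ("Dirichlet-typical
  `Y` are torus-atypical at large-deviation scale") made quantitative — it fails iff the Dirichlet/torus
  entropy of the environment law is super-surface, e.g. through an unscreened long-range distortion of the
  torus state by the wall conditioning.

Composition `TorusLandscapeDirichletTypical_of` (PROVED below, no `sorry`): `a₀ := max`, `ρ₀ := min`;
given `η` take `η₀ := η/2 ↦ K` (stub 2), `κ := K + 1 ↦ c` (stub 1); eventually in `N`:
`w_D(Bad(c)) ≤ η/2 + e^(K N^(2/3)) π_P(Bad(c)) ≤ η/2 + e^(K N^(2/3)) e^(−(K+1) N^(2/3)) = η/2 + e^(−N^(2/3)) ≤ η`,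
using (i) measurability of `Bad(c)` (`measurableSet_landscapeBad`: `Φ₀` continuous ⇒ the slice integrals
`Y ↦ ∫⁻_Λ' ofReal (Φ₀(x::Y))`, `Y ↦ ∫⁻_Λ' ofReal (Φ₀(x::Y)²)` are measurable by Tonelli measurability,
then `measurableSet_le`), (ii) `eventually_exp_neg_rpow_le` (`e^(−N^(2/3)) → 0`), (iii) the `ℝ≥0∞`
arithmetic `exp_budget`.  Neither stub alone gives T: stub 1 speaks of `π_P` only, stub 2 has no landscape
content (BC3 probes `stub → T`, `stub → BoseEinsteinCondensation` by `first | exact? | simpa | aesop` fail,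
table in `birth.md`).  Neither restates T, the summit, or a statement in `ledger negatives`.

## Disproof / evidence honoured

No `Disproof.lean` exists for this crux (`ledger crux ls`: no workfiles before this one).  Item evidence
(refuter rattack-13826 ATTACK.md/W0.lean, rreview-0815, grounder g25-25): T survives; free gas `v ≡ 0` has
EMPTY bad set at `c = 1/2` — consistent: stub 1 then holds with `Bad(c) = ∅` for `c < 1`, stub 2 for the free
gas is the explicit product computation; the junk branch (`¬∃` ground state ⇒ `groundState = 0`) makes
stub 2 and T trivial alike; "Markov from `π_P`-averages gives only bad mass `≤ (1−f₀)/(1−c)`, not `∀ η`" is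
exactly why stub 1 is stated as a large-deviation bound and not as an average.

## Audit expectations (BC3)

`lean check --json`: rc 0; sorries = 2 = stubs (`stub_torusLandscapeLD`, `stub_wallConditioningDomination`),
zero elsewhere; `TorusLandscapeDirichletTypical_of` sorry-free (axioms ⊆ propext, Classical.choice,
Quot.sound) and concludes `Summit.AtomisticToContinuum.BoseEinsteinCondensation.Theses.BECWallDressingTransfer.TorusLandscapeDirichletTypical` BY NAME.
Stub signatures are `let`-free (the crux's `let L / Ψ₀ / Λ'` replaced by the binders
`∀ L, L = sideLength ρ (N + 1) → …`, `∀ Λ', Λ' = {…} → …`, instantiated by `rfl` in the composition) so the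
registrar's signature scan (cuts at the first `:=`) records them whole.  The hypotheses of `_of` are the
name-keyed handles `__Registered.stub_X : Prop` (definitionally the stub statements; device of
`Cruxes/OneBodyLogHarnack/Lines/birth.lean`), which `#h21_check_skeleton` admits by the stub name.
-/

noncomputable section

open MeasureTheory Filter Set
open scoped ENNReal Topology

namespace Summit.AtomisticToContinuum.BoseEinsteinCondensation.Cruxes.TorusLandscapeDirichletTypical.Birth

open Literature.MathematicalPhysics.QuantumManyBody.BoseGas

/-! ### Registered stubs (the ONLY sorries of this file) -/

/-- **Stub 1 — `TorusLandscapeTypical` in large-deviation form at surface speed (size XL; torus side only).**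
For admissible `v`: `∃ a₀ ≥ 0, ∀ a ≥ a₀`, at small `ρ`, for `ε ∈ [0,1/4)` and every rate `κ > 0` there is
`c > 0` such that eventually in `N`, for every torus ground state `Φ₀` of `N + 1` bosons on the torus of
side `L + a` (the crux's inlined interface, `L = sideLength ρ (N + 1)`), the TORUS-law mass of the
landscape-bad environments is exponentially small:
`∫⁻_{Y ∈ cell^N} 1_{Bad(c)}(Y) · ∫⁻_cell Φ₀(x::Y)² dx dY ≤ exp(−κ N^(2/3))`,
`Bad(c) = {Y | (∫⁻_Λ' Φ₀(x::Y))² ≤ c |Λ'| ∫⁻_Λ' Φ₀(x::Y)²}`, `Λ' = (εL, L−εL)³`, `cell = [0, L+a)³`.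
(The interface pins `∫_{cell^(N+1)} Φ₀² = 1`, so the left side is a probability.)  Intended proofs:
bulk large deviations for the occupation of `Λ'` by the environment under the homogeneous torus state +
a deterministic landscape bound given a density cap (Jastrow/Jensen caricature: `Bad(c) = ∅` for small `c`).
Leans on: `PeriodicTrialState`, `periodicEnergy`, `periodicGroundStateEnergy`, `cellN`, `cell`,
`sideLength`; LSSY2005 Ch. 2–5, Fournais2020 (Thm 1.2 = `Fournais2020_condensation`, averaged only),
arXiv:2603.20776, arXiv:2510.20493. -/
theorem stub_torusLandscapeLD :
      ∀ v : ℝ → ENNReal, IsRepulsiveFiniteRange v → ∃ a₀ : ℝ, 0 ≤ a₀ ∧ ∀ a : ℝ, a₀ ≤ a → ∃ ρ₀ : ℝ, 0 < ρ₀ ∧ ∀ ρ : ℝ,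
      0 < ρ → ρ < ρ₀ → ∀ ε : ℝ, 0 ≤ ε → ε < 1 / 4 → ∀ κ : ℝ, 0 < κ → ∃ c : ℝ, 0 < c ∧ ∀ᶠ N : ℕ in Filter.atTop, ∀ L
      : ℝ, L = sideLength ρ (N + 1) → ∀ Φ₀ : Config (N + 1) → ℝ, (Continuous Φ₀ ∧ (∀ (X : Config (N + 1)) (i : Fin
      (N + 1)) (k : Fin 3), Φ₀ (X + Pi.single i (EuclideanSpace.single k (L + a))) = Φ₀ X) ∧ (∀ X, 0 ≤ Φ₀ X) ∧ ∀ η'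
      : ℝ, 0 < η' → ∃ δ : ENNReal, 0 < δ ∧ ∀ Φ : PeriodicTrialState (N + 1) (L + a), periodicEnergy v Φ ≤
      periodicGroundStateEnergy v (N + 1) (L + a) + δ → ∃ θ : ℝ, ∫⁻ X in cellN (N + 1) (L + a), (‖Φ.ψ X -
      Complex.exp (↑θ * Complex.I) * (Φ₀ X : ℂ)‖₊ : ENNReal) ^ 2 ≤ ENNReal.ofReal η') → ∀ Λ' : Set Space, Λ' = {z :
      Space | ∀ j, z j ∈ Set.Ioo (ε * L) (L - ε * L)} → (∫⁻ Y in cellN N (L + a), Set.indicator {Y : Config N | (∫⁻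
      x in Λ', ENNReal.ofReal (Φ₀ (Matrix.vecCons x Y))) ^ 2 ≤ ENNReal.ofReal c * MeasureTheory.volume Λ' * ∫⁻ x in
      Λ', ENNReal.ofReal (Φ₀ (Matrix.vecCons x Y) ^ 2)} (fun _ => (1 : ENNReal)) Y * (∫⁻ x in cell (L + a),
      ENNReal.ofReal (Φ₀ (Matrix.vecCons x Y) ^ 2))) ≤ ENNReal.ofReal (Real.exp (-(κ * (N : ℝ) ^ (2 / 3 : ℝ)))) := by
  sorry

/-- **Stub 2 — `WallConditioningStability` as smoothed exponential domination at surface speed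
(size L–XL; the change of measure Dirichlet-law ↔ torus-law of the environment).**
For admissible `v`: `∃ a₀ ≥ 0, ∀ a ≥ a₀` (the prover may take `a₀ >` range, so that no periodic image of an
environment in the box meets a hard core), at small `ρ`, for every `η₀ > 0` there is `K > 0` such that
eventually in `N`, if the Dirichlet ground state `Ψ₀ = groundState v (N+1) L` is unique, for every torus
ground state `Φ₀` of side `L + a` (interface) and EVERY measurable set `E` of environments:
`∫⁻ 1_E(Y) ∫⁻ Ψ₀(x::Y)² dx dY ≤ η₀ + exp(K N^(2/3)) · ∫⁻_{Y ∈ cell^N} 1_E(Y) ∫⁻_cell Φ₀(x::Y)² dx dY`.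
Follows from the surface-order relative entropy bound `H(w_D | π_P) ≤ K' N^(2/3)` by the entropy
inequality `w_D(E) ≤ (H + log 2)/log(1/π_P(E))` with `K = (K' + 1)/η₀`.  Leans on: `groundState`,
`HasUniqueGroundState`, `lintegral_groundState_sq`, `groundState_eq_zero_of_not_mem`; Mathlib
`InformationTheory.klDiv` (optional); LSSY2005 Ch. 2 (after (2.8)), Robinson1976 (boundary free energy is
surface order — energies only in print). -/
theorem stub_wallConditioningDomination :
      ∀ v : ℝ → ENNReal, IsRepulsiveFiniteRange v → ∃ a₀ : ℝ, 0 ≤ a₀ ∧ ∀ a : ℝ, a₀ ≤ a → ∃ ρ₀ : ℝ, 0 < ρ₀ ∧ ∀ ρ : ℝ,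
      0 < ρ → ρ < ρ₀ → ∀ η₀ : ℝ, 0 < η₀ → ∃ K : ℝ, 0 < K ∧ ∀ᶠ N : ℕ in Filter.atTop, ∀ L : ℝ, L = sideLength ρ (N +
      1) → HasUniqueGroundState v (N + 1) L → ∀ Φ₀ : Config (N + 1) → ℝ, (Continuous Φ₀ ∧ (∀ (X : Config (N + 1)) (i
      : Fin (N + 1)) (k : Fin 3), Φ₀ (X + Pi.single i (EuclideanSpace.single k (L + a))) = Φ₀ X) ∧ (∀ X, 0 ≤ Φ₀ X) ∧
      ∀ η' : ℝ, 0 < η' → ∃ δ : ENNReal, 0 < δ ∧ ∀ Φ : PeriodicTrialState (N + 1) (L + a), periodicEnergy v Φ ≤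
      periodicGroundStateEnergy v (N + 1) (L + a) + δ → ∃ θ : ℝ, ∫⁻ X in cellN (N + 1) (L + a), (‖Φ.ψ X -
      Complex.exp (↑θ * Complex.I) * (Φ₀ X : ℂ)‖₊ : ENNReal) ^ 2 ≤ ENNReal.ofReal η') → ∀ E : Set (Config N),
      MeasurableSet E → (∫⁻ Y : Config N, Set.indicator E (fun _ => (1 : ENNReal)) Y * (∫⁻ x : Space, ENNReal.ofReal
      (groundState v (N + 1) L (Matrix.vecCons x Y) ^ 2))) ≤ ENNReal.ofReal η₀ + ENNReal.ofReal (Real.exp (K * (N :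
      ℝ) ^ (2 / 3 : ℝ))) * (∫⁻ Y in cellN N (L + a), Set.indicator E (fun _ => (1 : ENNReal)) Y * (∫⁻ x in cell (L +
      a), ENNReal.ofReal (Φ₀ (Matrix.vecCons x Y) ^ 2))) := by
  sorry

/-! ### Glue lemmas (proved) -/

/-- `(x, Y) ↦ x :: Y` is jointly measurable. [folklore] -/
theorem measurable_vecCons_prod (N : ℕ) :
    Measurable fun p : Space × Config N => (Matrix.vecCons p.1 p.2 : Config (N + 1)) :=
  (continuous_fst.matrixVecCons continuous_snd).measurable

/-- Tonelli measurability of a slice integral `Y ↦ ∫⁻ g(Φ₀(x :: Y)) dμ(x)` for continuous `Φ₀` and an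
s-finite measure `μ` on one-particle space (e.g. `volume.restrict Λ'`). [folklore] -/
theorem measurable_sliceLIntegral {N : ℕ} {Φ₀ : Config (N + 1) → ℝ} (hΦ : Continuous Φ₀)
    (μ : Measure Space) [SFinite μ] (g : ℝ → ℝ≥0∞) (hg : Measurable g) :
    Measurable fun Y : Config N => ∫⁻ x, g (Φ₀ (Matrix.vecCons x Y)) ∂μ := by
  have h : Measurable (Function.uncurry fun (x : Space) (Y : Config N) => g (Φ₀ (Matrix.vecCons x Y))) :=
    hg.comp (hΦ.measurable.comp (measurable_vecCons_prod N))
  exact h.lintegral_prod_left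

/-- The landscape-bad event `{Y | (∫⁻_S ofReal Φ₀(x::Y))² ≤ b · |S| · ∫⁻_S ofReal (Φ₀(x::Y)²)}` is
measurable for continuous `Φ₀` (any set `S`, any `b`). [folklore] -/
theorem measurableSet_landscapeBad {N : ℕ} {Φ₀ : Config (N + 1) → ℝ} (hΦ : Continuous Φ₀)
    (S : Set Space) (b : ℝ≥0∞) :
    MeasurableSet {Y : Config N | (∫⁻ x in S, ENNReal.ofReal (Φ₀ (Matrix.vecCons x Y))) ^ 2 ≤
      b * MeasureTheory.volume S * ∫⁻ x in S, ENNReal.ofReal (Φ₀ (Matrix.vecCons x Y) ^ 2)} := by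
  have h1 : Measurable fun Y : Config N => ∫⁻ x in S, ENNReal.ofReal (Φ₀ (Matrix.vecCons x Y)) :=
    measurable_sliceLIntegral hΦ (volume.restrict S) (fun t => ENNReal.ofReal t) ENNReal.measurable_ofReal
  have h2 : Measurable fun Y : Config N => ∫⁻ x in S, ENNReal.ofReal (Φ₀ (Matrix.vecCons x Y) ^ 2) :=
    measurable_sliceLIntegral hΦ (volume.restrict S) (fun t => ENNReal.ofReal (t ^ 2))
      (ENNReal.measurable_ofReal.comp (measurable_id.pow_const 2))
  exact measurableSet_le (h1.pow_const 2) (h2.const_mul _)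

/-- `exp(−N^(2/3)) ≤ η` eventually in `N`, for `η > 0`. [folklore] -/
theorem eventually_exp_neg_rpow_le {η : ℝ} (hη : 0 < η) :
    ∀ᶠ N : ℕ in atTop, Real.exp (-((N : ℝ) ^ (2 / 3 : ℝ))) ≤ η := by
  have h1 : Tendsto (fun N : ℕ => (N : ℝ) ^ (2 / 3 : ℝ)) atTop atTop :=
    (tendsto_rpow_atTop (by norm_num)).comp tendsto_natCast_atTop_atTop
  have h2 : Tendsto (fun N : ℕ => Real.exp (-((N : ℝ) ^ (2 / 3 : ℝ)))) atTop (𝓝 0) :=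
    Real.tendsto_exp_atBot.comp (tendsto_neg_atTop_atBot.comp h1)
  exact h2.eventually (eventually_le_nhds hη)

/-- The `ℝ≥0∞` budget: `η/2 + e^(Ks) · e^(−(K+1)s) ≤ η` once `e^(−s) ≤ η/2`. [folklore] -/
theorem exp_budget {η K s : ℝ} (hη : 0 < η) (hs : Real.exp (-s) ≤ η / 2) :
    ENNReal.ofReal (η / 2) +
        ENNReal.ofReal (Real.exp (K * s)) * ENNReal.ofReal (Real.exp (-((K + 1) * s))) ≤
      ENNReal.ofReal η := by
  have hmul : ENNReal.ofReal (Real.exp (K * s)) * ENNReal.ofReal (Real.exp (-((K + 1) * s))) =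
      ENNReal.ofReal (Real.exp (-s)) := by
    rw [← ENNReal.ofReal_mul (Real.exp_pos _).le, ← Real.exp_add,
      show K * s + -((K + 1) * s) = -s by ring]
  rw [hmul, ← ENNReal.ofReal_add (half_pos hη).le (Real.exp_pos (-s)).le]
  exact ENNReal.ofReal_le_ofReal (by linarith)

/-! ### Name-keyed handles of the stub statements (hypotheses of `TorusLandscapeDirichletTypical_of`)

`#h21_check_skeleton` admits a `Prop` hypothesis of the skeleton theorem only if its head constant is a
registered obligation or is NAMED like a declared stub; `__Registered.stub_X : Prop` is the statement of
`stub_X` under that short name (the `__` component is an implementation-detail name, skipped by the audit's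
declaration scan, so the stub report resolves `stub_X` to the sorried theorem above).  Texts generated from
ONE source string (seat folder `gen_birth.py`); the `example`s check each handle IS its stub, definitionally. -/
namespace __Registered

/-- Statement of `stub_torusLandscapeLD`, keyed by the registered stub name. -/
abbrev stub_torusLandscapeLD : Prop :=
      ∀ v : ℝ → ENNReal, IsRepulsiveFiniteRange v → ∃ a₀ : ℝ, 0 ≤ a₀ ∧ ∀ a : ℝ, a₀ ≤ a → ∃ ρ₀ : ℝ, 0 < ρ₀ ∧ ∀ ρ : ℝ,
      0 < ρ → ρ < ρ₀ → ∀ ε : ℝ, 0 ≤ ε → ε < 1 / 4 → ∀ κ : ℝ, 0 < κ → ∃ c : ℝ, 0 < c ∧ ∀ᶠ N : ℕ in Filter.atTop, ∀ L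
      : ℝ, L = sideLength ρ (N + 1) → ∀ Φ₀ : Config (N + 1) → ℝ, (Continuous Φ₀ ∧ (∀ (X : Config (N + 1)) (i : Fin
      (N + 1)) (k : Fin 3), Φ₀ (X + Pi.single i (EuclideanSpace.single k (L + a))) = Φ₀ X) ∧ (∀ X, 0 ≤ Φ₀ X) ∧ ∀ η'
      : ℝ, 0 < η' → ∃ δ : ENNReal, 0 < δ ∧ ∀ Φ : PeriodicTrialState (N + 1) (L + a), periodicEnergy v Φ ≤
      periodicGroundStateEnergy v (N + 1) (L + a) + δ → ∃ θ : ℝ, ∫⁻ X in cellN (N + 1) (L + a), (‖Φ.ψ X -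
      Complex.exp (↑θ * Complex.I) * (Φ₀ X : ℂ)‖₊ : ENNReal) ^ 2 ≤ ENNReal.ofReal η') → ∀ Λ' : Set Space, Λ' = {z :
      Space | ∀ j, z j ∈ Set.Ioo (ε * L) (L - ε * L)} → (∫⁻ Y in cellN N (L + a), Set.indicator {Y : Config N | (∫⁻
      x in Λ', ENNReal.ofReal (Φ₀ (Matrix.vecCons x Y))) ^ 2 ≤ ENNReal.ofReal c * MeasureTheory.volume Λ' * ∫⁻ x in
      Λ', ENNReal.ofReal (Φ₀ (Matrix.vecCons x Y) ^ 2)} (fun _ => (1 : ENNReal)) Y * (∫⁻ x in cell (L + a),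
      ENNReal.ofReal (Φ₀ (Matrix.vecCons x Y) ^ 2))) ≤ ENNReal.ofReal (Real.exp (-(κ * (N : ℝ) ^ (2 / 3 : ℝ))))

/-- Statement of `stub_wallConditioningDomination`, keyed by the registered stub name. -/
abbrev stub_wallConditioningDomination : Prop :=
      ∀ v : ℝ → ENNReal, IsRepulsiveFiniteRange v → ∃ a₀ : ℝ, 0 ≤ a₀ ∧ ∀ a : ℝ, a₀ ≤ a → ∃ ρ₀ : ℝ, 0 < ρ₀ ∧ ∀ ρ : ℝ,
      0 < ρ → ρ < ρ₀ → ∀ η₀ : ℝ, 0 < η₀ → ∃ K : ℝ, 0 < K ∧ ∀ᶠ N : ℕ in Filter.atTop, ∀ L : ℝ, L = sideLength ρ (N +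
      1) → HasUniqueGroundState v (N + 1) L → ∀ Φ₀ : Config (N + 1) → ℝ, (Continuous Φ₀ ∧ (∀ (X : Config (N + 1)) (i
      : Fin (N + 1)) (k : Fin 3), Φ₀ (X + Pi.single i (EuclideanSpace.single k (L + a))) = Φ₀ X) ∧ (∀ X, 0 ≤ Φ₀ X) ∧
      ∀ η' : ℝ, 0 < η' → ∃ δ : ENNReal, 0 < δ ∧ ∀ Φ : PeriodicTrialState (N + 1) (L + a), periodicEnergy v Φ ≤
      periodicGroundStateEnergy v (N + 1) (L + a) + δ → ∃ θ : ℝ, ∫⁻ X in cellN (N + 1) (L + a), (‖Φ.ψ X -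
      Complex.exp (↑θ * Complex.I) * (Φ₀ X : ℂ)‖₊ : ENNReal) ^ 2 ≤ ENNReal.ofReal η') → ∀ E : Set (Config N),
      MeasurableSet E → (∫⁻ Y : Config N, Set.indicator E (fun _ => (1 : ENNReal)) Y * (∫⁻ x : Space, ENNReal.ofReal
      (groundState v (N + 1) L (Matrix.vecCons x Y) ^ 2))) ≤ ENNReal.ofReal η₀ + ENNReal.ofReal (Real.exp (K * (N :
      ℝ) ^ (2 / 3 : ℝ))) * (∫⁻ Y in cellN N (L + a), Set.indicator E (fun _ => (1 : ENNReal)) Y * (∫⁻ x in cell (L +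
      a), ENNReal.ofReal (Φ₀ (Matrix.vecCons x Y) ^ 2)))

end __Registered

example : __Registered.stub_torusLandscapeLD := stub_torusLandscapeLD
example : __Registered.stub_wallConditioningDomination := stub_wallConditioningDomination

/-! ### The composition: the two stub statements imply the crux, BY NAME (no `sorry` below) -/

/-- **Composition.** `stub_torusLandscapeLD → stub_wallConditioningDomination → TorusLandscapeDirichletTypical`
(the route decl, by name).  `a₀ := max a₁ a₂`, `ρ₀ := min ρ₁ ρ₂`; given `ε, η`: `η₀ := η/2 ↦ K` from stub 2,
`κ := K + 1 ↦ c` from stub 1; on the intersection of the three eventual sets (stub 1, stub 2,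
`e^(−N^(2/3)) ≤ η/2`) zeta-reduce the crux's `let`s, instantiate the stubs' `L`/`Λ'` binders by `rfl`,
discharge measurability of `Bad(c)` by `measurableSet_landscapeBad`, and chain
`w_D(Bad) ≤ η/2 + e^(KN^(2/3)) π_P(Bad) ≤ η/2 + e^(KN^(2/3)) e^(−(K+1)N^(2/3)) ≤ η` (`gcongr` with stub 1,
then `exp_budget`). [folklore] -/
theorem TorusLandscapeDirichletTypical_of
    (h₁ : __Registered.stub_torusLandscapeLD) (h₂ : __Registered.stub_wallConditioningDomination) :
    Summit.AtomisticToContinuum.BoseEinsteinCondensation.Theses.BECWallDressingTransfer.TorusLandscapeDirichletTypical := by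
  intro v hv
  obtain ⟨a₁, ha₁, hA₁⟩ := h₁ v hv
  obtain ⟨a₂, ha₂, hA₂⟩ := h₂ v hv
  refine ⟨max a₁ a₂, ha₁.trans (le_max_left _ _), fun a ha => ?_⟩
  obtain ⟨ρ₁, hρ₁, hR₁⟩ := hA₁ a ((le_max_left _ _).trans ha)
  obtain ⟨ρ₂, hρ₂, hR₂⟩ := hA₂ a ((le_max_right _ _).trans ha)
  refine ⟨min ρ₁ ρ₂, lt_min hρ₁ hρ₂, fun ρ hρ hρlt ε hε₀ hε₁ η hη => ?_⟩
  obtain ⟨K, hK, hev₂⟩ := hR₂ ρ hρ (hρlt.trans_le (min_le_right _ _)) (η / 2) (half_pos hη)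
  obtain ⟨c, hc, hev₁⟩ :=
    hR₁ ρ hρ (hρlt.trans_le (min_le_left _ _)) ε hε₀ hε₁ (K + 1) (by linarith)
  refine ⟨c, hc, ?_⟩
  filter_upwards [hev₁, hev₂, eventually_exp_neg_rpow_le (half_pos hη)] with N hN₁ hN₂ hN₃
  dsimp only
  intro hU Φ₀ hΦ
  refine (hN₂ _ rfl hU Φ₀ hΦ _ (measurableSet_landscapeBad hΦ.1 _ _)).trans ?_
  have hP := hN₁ _ rfl Φ₀ hΦ _ rfl
  refine le_trans ?_ (exp_budget (K := K) (s := (N : ℝ) ^ (2 / 3 : ℝ)) hη hN₃)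
  gcongr

/-- Sanity: the sorried stubs themselves feed the composition (this `example` carries `sorryAx` only
through the two `stub_*`; it becomes the closing proof when they land). -/
example : Summit.AtomisticToContinuum.BoseEinsteinCondensation.Theses.BECWallDressingTransfer.TorusLandscapeDirichletTypical :=
  TorusLandscapeDirichletTypical_of stub_torusLandscapeLD stub_wallConditioningDomination

end Summit.AtomisticToContinuum.BoseEinsteinCondensation.Cruxes.TorusLandscapeDirichletTypical.Birth

end
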